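import Summits.CriticalPhenomena.PercolationContinuityZ3.Theorems.Transplant.PlanarSkeletonFrmQuasiDefs
import Summits.CriticalPhenomena.PercolationContinuityZ3.Theorems.Transplant.SkelFrmQuasiBChoiceResidF
import Summits.CriticalPhenomena.PercolationContinuityZ3.Theorems.Transplant.SkelFrmBChoiceResidF
import Summits.CriticalPhenomena.PercolationContinuityZ3.Theorems.Transplant.SkelFrmQuasiBParamsFaceBandAR0
import Summits.CriticalPhenomena.PercolationContinuityZ3.Theorems.Transplant.SkelFrmBParamsFaceBandAR0
import Summits.CriticalPhenomena.PercolationContinuityZ3.Theorems.Transplant.SkelFrmQuasiBParamsFaceBandA2R0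
import Summits.CriticalPhenomena.PercolationContinuityZ3.Theorems.Transplant.SkelFrmBParamsFaceBandA2R0
import Summits.CriticalPhenomena.PercolationContinuityZ3.Theorems.Transplant.SkelFrmQuasiBParamsFaceLamA
import Summits.CriticalPhenomena.PercolationContinuityZ3.Theorems.Transplant.SkelFrmBParamsFaceLamA
import Summits.CriticalPhenomena.PercolationContinuityZ3.Theorems.Transplant.SkelFrmQuasiBParamsFaceCountsRangeA
import Summits.CriticalPhenomena.PercolationContinuityZ3.Theorems.Transplant.SkelFrmBParamsFaceCountsRangeA
import Summits.CriticalPhenomena.PercolationContinuityZ3.Theorems.Transplant.SkelFrmQuasi1SlotTypes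
import HarnessLib
import Summits.CriticalPhenomena.PercolationContinuityZ3.Theorems.Transplant.SkelFrmBParamsFaceFloorsHypsF
/-!
# GEN-Q PORT (WAVE-Q table v0.8 section 2, row G216, U-level L22; captain R-6/R-7 2026-08-27: carrier token swap `PlanarSkeletonFrmFrom ↦ PlanarSkeletonFrmQuasi`)
# of the tree module «Transplant/SkelFrmFromBParamsFaceFloorsHypsF» (sha256 19a624c4e5d2089f…) onto the quasi-step carrier `PlanarSkeletonFrmQuasi` (p507026): «SkelFrmQuasiBParamsFaceFloorsHypsF»

HAND HUNK (L-FLOORMAP-1 ①⑥ / L-KitS-1 reader side; G017 «SkelFrmQuasiBChoiceNums», hp-8's KitSN): R'0×14, Rlev0×6, R'0_eq×1, reach0×6 — the (S0) kit of record at window cost `KS.NQ Φ`.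

ORIGINAL TITLE: N2 (frames-only node, OPEN) — (F) column, DISCHARGE LAYER part 1: **THE STANDARD HYPOTHESES OF THE TWO FACE ASSEMBLIES AT ANY DOMINATING SLOT VALUE**

builds on p205010 (kernel theorem, internal audit signed; external expert review pending) — nothing in this file uses p205010; NOTHING is claimed about any open node
((N3-b), the end state).  Lane `prim-bschramm`, seat `prim-bschramm-stmt` (gen 33; GEN-Q column pen; tool = captain gen-1 g4's port_genq.py R-14 --cone + p3-g30's T1 patch).  Helper file (`--supports stmt-CriticalPhenomena-4575 --as helper`).
PORT RULES (U-wave r1–r4 re-used, GEN-Q hunk classes of p3-g29 #6136): declaration order, names and proof texts are those of «SkelFrmFromBParamsFaceFloorsHypsF», byte-identical except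
(i) the carrier token `PlanarSkeletonFrmFrom ↦ PlanarSkeletonFrmQuasi` in binders, `namespace`/`end` lines and qualified names (module names `SkelFrmFrom… ↦ SkelFrmQuasi…`
in imports of already-ported rows); (ii) `Φ.step ↦ Φ.qstep` with the called Steps lemma replaced by its `…Q`/`_q` twin and the cost `Φ.M` threaded (none in this file unless
listed below); (iii) `Φ.cyl_connected ↦ Φ.cyl_reach` readers (none unless listed); (iv) graph-ball radii / window floors ×`Φ.M` (none unless listed).  Carrier-free
residents stay imported/exported from the original «SkelFrmBParamsFaceFloorsHypsF» exactly as in the FrmFrom port.  Docstrings and citations are the original's.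

-/

noncomputable section

open scoped Classical

namespace Summit.CriticalPhenomena.PercolationContinuityZ3.Theorems.Transplant

namespace PlanarSkeletonFrmQuasi

namespace NegB

namespace KS

open Literature.Probability.Percolation Literature.Probability.LatticeModels SimpleGraph
open Literature.Probability.Percolation.KozmaNitzan.Cells (oth)
open SkelConc (Consts)
open Skelφ.StepI (DataNS)
open Neg

section Hyps

variable (κ : Consts) {V : Type} [DecidableEq V] [Countable V] {G : SimpleGraph V} [G.LocallyFinite] (Φ : PlanarSkeletonFrmQuasi G) (t : V) (p : unitInterval)
  (D : DataNS V) (c mk : ℕ) (gx fx : Neg.FSlot)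

/-- **The slot floors of the (F) assemblies** at any `(gx, fx) ⊒ (gxFc mk c, fxFc mk)`: `hnA`, `hnA24`, `hℓA`, `hS`, `hS64`, `hMR0`, `hMR0K`, `hRn0`. [folklore] -/
theorem slotsF_hyps (κ : Consts) {V : Type} [DecidableEq V] [Countable V] {G : SimpleGraph V} [G.LocallyFinite] (Φ : PlanarSkeletonFrmQuasi G) (t : V) (p : unitInterval) (D : DataNS V) (c : ℕ) (mk : ℕ) (gx : Neg.FSlot) (fx : Neg.FSlot) (hgx : ∀ D : DataNS V, gxFc mk c κ Φ t p D ≤ gx κ Φ t p D) (hfx : ∀ D : DataNS V, fxFc mk κ Φ t p D ≤ fx κ Φ t p D)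
    (hN : EqNumL κ Φ t p D (gT mk gx κ Φ t p D) (fT mk fx κ Φ t p D)) :
    2000 * Neg.Kq κ * (KS0.R'0N κ Φ (KS.NQ Φ) t p D mk + 2) ≤ nL κ Φ t p D (gT mk gx κ Φ t p D) (fT mk fx κ Φ t p D) ∧
    2400 * Neg.Kq κ * (KS0.R'0N κ Φ (KS.NQ Φ) t p D mk + 2) ≤ nL κ Φ t p D (gT mk gx κ Φ t p D) (fT mk fx κ Φ t p D) ∧
    22000 * Neg.Kq κ * (KS0.R'0N κ Φ (KS.NQ Φ) t p D mk + 2) ≤ ℓL κ Φ t p D (gT mk gx κ Φ t p D) (fT mk fx κ Φ t p D) ∧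
    16 * SF κ Φ t p D c mk ≤ ML κ Φ t p D (gT mk gx κ Φ t p D) ∧ 64 * SF κ Φ t p D c mk ≤ ML κ Φ t p D (gT mk gx κ Φ t p D) ∧
    22000 * (KS0.R'0N κ Φ (KS.NQ Φ) t p D mk + 2) ≤ ML κ Φ t p D (gT mk gx κ Φ t p D) ∧
    22000 * Neg.Kq κ * (KS0.R'0N κ Φ (KS.NQ Φ) t p D mk + 2) ≤ ML κ Φ t p D (gT mk gx κ Φ t p D) ∧
    KS0.R'0N κ Φ (KS.NQ Φ) t p D mk ≤ nL κ Φ t p D (gT mk gx κ Φ t p D) (fT mk fx κ Φ t p D) :=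
  ⟨hnAF_of_ge hfx D _, hnA24_of_ge hfx D _, hℓAF_of_ge hgx D hN, hS_of_ge hgx D, hS64_of_ge hgx D, (hR0F_of_ge hgx D).2,
    (hR0F_of_ge hgx D).1, hRn0F_of_ge hfx D _⟩

/-- **The cell-unit rows and the zone bounds**: `6R'0+11 ≤ u₀A`, `14R'0+27 ≤ u₁A`, `2 ≤ u₁A`, `kF₀A ≤ 8u₀A + 1`, `kF₁A ≤ 8u₁A + 1`. [folklore] -/
theorem cellsF_hyps (κ : Consts) {V : Type} [DecidableEq V] [Countable V] {G : SimpleGraph V} [G.LocallyFinite] (Φ : PlanarSkeletonFrmQuasi G) (t : V) (p : unitInterval) (D : DataNS V) (c : ℕ) (mk : ℕ) (gx : Neg.FSlot) (fx : Neg.FSlot) (hgx : ∀ D : DataNS V, gxFc mk c κ Φ t p D ≤ gx κ Φ t p D)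
    (hN : EqNumL κ Φ t p D (gT mk gx κ Φ t p D) (fT mk fx κ Φ t p D))
    (hκ : (hL κ Φ t p D (gT mk gx κ Φ t p D) (fT mk fx κ Φ t p D)).natAbs ≤ 10 * nL κ Φ t p D (gT mk gx κ Φ t p D) (fT mk fx κ Φ t p D)) :
    6 * (KS0.R'0N κ Φ (KS.NQ Φ) t p D mk : ℤ) + 11 ≤ u₀A κ Φ t p D (gT mk gx κ Φ t p D) (fT mk fx κ Φ t p D) ∧
    14 * (KS0.R'0N κ Φ (KS.NQ Φ) t p D mk : ℤ) + 27 ≤ u₁A κ Φ t p D (gT mk gx κ Φ t p D) (fT mk fx κ Φ t p D) ∧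
    2 ≤ u₁A κ Φ t p D (gT mk gx κ Φ t p D) (fT mk fx κ Φ t p D) ∧
    kF₀A κ Φ t p D c mk (gT mk gx κ Φ t p D) (fT mk fx κ Φ t p D) ≤ 8 * u₀A κ Φ t p D (gT mk gx κ Φ t p D) (fT mk fx κ Φ t p D) + 1 ∧
    kF₁A κ Φ t p D c mk (gT mk gx κ Φ t p D) (fT mk fx κ Φ t p D) ≤ 8 * u₁A κ Φ t p D (gT mk gx κ Φ t p D) (fT mk fx κ Φ t p D) + 1 := by
  obtain ⟨hMR0K, hMR0⟩ := hR0F_of_ge hgx D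
  have hS := hS_of_ge hgx D
  obtain ⟨h4K, -⟩ := ML_floorR0_of_Kq κ Φ t p D (gT mk gx κ Φ t p D) mk hMR0K
  obtain ⟨hs0, hs1⟩ := cells_geR0A κ Φ t p D (gT mk gx κ Φ t p D) (fT mk fx κ Φ t p D) mk hN hκ h4K
  obtain ⟨hk0, hk1⟩ := kFA_le κ Φ t p D c mk gx (fT mk fx κ Φ t p D) hN hκ hMR0 hS
  have hR : (0 : ℤ) ≤ (KS0.R'0N κ Φ (KS.NQ Φ) t p D mk : ℤ) := by positivity
  refine ⟨hs0, hs1, ?_, hk0, hk1⟩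
  show (2 : ℤ) ≤ (((fcellsA κ Φ t p D (gT mk gx κ Φ t p D) (fT mk fx κ Φ t p D)).s 1 : ℕ) : ℤ)
  linarith

/-- **The face band `E := Rlev0 + reach0`**: `E ≤ 2·R'0` (indeed `E = R'0 − 1 + reach0 ≤ 2R'0 − 2`), `E − 1 ≤ 2·R'0`, and `E ≤ u₀A`, `E ≤ u₁A` under the
cell-unit rows. [folklore] -/
theorem bandF_facts (κ : Consts) {V : Type} [DecidableEq V] [Countable V] {G : SimpleGraph V} [G.LocallyFinite] (Φ : PlanarSkeletonFrmQuasi G) (t : V) (p : unitInterval) (D : DataNS V) (c : ℕ) (mk : ℕ) (gx : Neg.FSlot) (fx : Neg.FSlot) (hgx : ∀ D : DataNS V, gxFc mk c κ Φ t p D ≤ gx κ Φ t p D)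
    (hN : EqNumL κ Φ t p D (gT mk gx κ Φ t p D) (fT mk fx κ Φ t p D))
    (hκ : (hL κ Φ t p D (gT mk gx κ Φ t p D) (fT mk fx κ Φ t p D)).natAbs ≤ 10 * nL κ Φ t p D (gT mk gx κ Φ t p D) (fT mk fx κ Φ t p D)) :
    (((KS0.Rlev0N κ Φ (KS.NQ Φ) t p D mk + KS0.reach0N (KS.NQ Φ) t D mk : ℕ) : ℤ) ≤ 2 * (KS0.R'0N κ Φ (KS.NQ Φ) t p D mk : ℤ)) ∧
    KS0.Rlev0N κ Φ (KS.NQ Φ) t p D mk + KS0.reach0N (KS.NQ Φ) t D mk - 1 ≤ 2 * KS0.R'0N κ Φ (KS.NQ Φ) t p D mk ∧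
    ((KS0.Rlev0N κ Φ (KS.NQ Φ) t p D mk + KS0.reach0N (KS.NQ Φ) t D mk : ℕ) : ℤ) ≤ u₀A κ Φ t p D (gT mk gx κ Φ t p D) (fT mk fx κ Φ t p D) ∧
    ((KS0.Rlev0N κ Φ (KS.NQ Φ) t p D mk + KS0.reach0N (KS.NQ Φ) t D mk : ℕ) : ℤ) ≤ u₁A κ Φ t p D (gT mk gx κ Φ t p D) (fT mk fx κ Φ t p D) := by
  obtain ⟨h1, h2, -⟩ := KS0.R'0N_eq κ Φ (KS.NQ Φ) t p D mk
  have hE : KS0.Rlev0N κ Φ (KS.NQ Φ) t p D mk + KS0.reach0N (KS.NQ Φ) t D mk ≤ 2 * KS0.R'0N κ Φ (KS.NQ Φ) t p D mk := by omega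
  have hE' : ((KS0.Rlev0N κ Φ (KS.NQ Φ) t p D mk + KS0.reach0N (KS.NQ Φ) t D mk : ℕ) : ℤ) ≤ 2 * (KS0.R'0N κ Φ (KS.NQ Φ) t p D mk : ℤ) := by exact_mod_cast hE
  obtain ⟨hs0, hs1, -⟩ := cellsF_hyps κ Φ t p D c mk gx fx hgx hN hκ
  have hR : (0 : ℤ) ≤ (KS0.R'0N κ Φ (KS.NQ Φ) t p D mk : ℤ) := by positivity
  exact ⟨hE', kit0Rl_le κ Φ t p D mk, by linarith, by linarith⟩

-- GEN-Q (R-2, captain 2026-08-27): `PlanarSkeletonFrmFrom.NegB.KS.bandX_hyps` is not in the used cone of the node top — not ported.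

-- GEN-Q (R-2, captain 2026-08-27): `PlanarSkeletonFrmFrom.NegB.KS.bandY_hyps` is not in the used cone of the node top — not ported.

end Hyps

end KS

end NegB

end PlanarSkeletonFrmQuasi

end Summit.CriticalPhenomena.PercolationContinuityZ3.Theorems.Transplant

end
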